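import Mathlib
import Summits.Ventures.HodgeRepro.Tier4.Common.LocalCoordinatesConj
import Summits.Ventures.HodgeRepro.Tier4.Line4.D3CoeffConj
import Summits.Ventures.HodgeRepro.Tier4.Line4.DefiniteCoeff
import Summits.Ventures.HodgeRepro.Tier4.Line4.ArchFactorProd

/-!
# Tier4/Line4/TorusWeightLocal — the product weight character `torusWeight'` of `T′(𝔸)` place by place: its value on a
LOCAL torus `T′_w` is the `w`-weight alone, it is multiplicative on `T′(𝔸)`, and on `T′_w` it EQUALS the display's
character `χ′` under the display's own binder `_hchi' w : ChiMatchesAt' … (eP′ w) (eM′ w) R.chi'` — the per-place half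
of the `arch_ne` matching `hmatch` of `archFactor_archWitness_ne_zero`

Blind re-derivation cell `pub-hodge-repro`, Tier 4 (README §9–§10), seat t4-L1-p5 (prover, gen 5; S15308 / S15317 (a);
the global half (b) — `∀ t′ ∈ T′_∞, χ′ t′ = Wt t′` — is the place split `T′_∞ = ∏_w T′_w`, typer-2's `Common/ArchAssemble`
(`assemble`, `ofPlace`, `assemble_ofPlace`, `map_assemble_eq_prod`), consumed when it lands).  Target tree path
`lean/Summits/Ventures/HodgeRepro/Tier4/Line4/TorusWeightLocal.lean`.  On typer-2's `Common/LocalCoordinatesConj`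
(p700125), `Common/RowWeights` (`weightAt_mul`, `weightAt_one`), the seat's `DefiniteCoeff` (p703816),
`ArchFactorProd` (p706229: `torusWeight'`); no printed input.

WHAT IS PROVED (kernel, no print):
* `locMat'_eq_one_of_mem_localTorusAt'_ne` / **`weightAt'_eq_one_of_mem_localTorusAt'_ne`** — the `T′`-adapted block at
  `w′` of an element of `T′_w`, `w ≠ w′`, is the identity; its weights at `w′` are `1`;
* **`torusWeight'_of_mem_localTorusAt'`** — on `T′_w`, `Wt(κ) = u₀(κ)_w^{−eP′ w} · u₁(κ)_w^{−eM′ w}`;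
* `weightAt'_one`, `weightAt'_mul_of_mem_torusT'`, **`torusWeight'_one` / `torusWeight'_mul`** — `Wt` is a character
  of `T′(𝔸)` (every infinite place real CM);
* **`chi'_eq_torusWeight'_of_chiMatchesAt'`** — for `κ ∈ T′_w`, `ChiMatchesAt' W q w g g' (eP′ w) (eM′ w) R.chi'` gives
  `R.chi' κ = Wt(κ)` (`χ′(κ) · u₀^{eP′} u₁^{eM′} = 1`).

Nothing here says anything about the status of the Hodge conjecture for CM abelian varieties, which is NOT proved
(HC_CM is NOT proved by anyone in this repository).
-/

set_option autoImplicit false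

noncomputable section

namespace Summit.Ventures.HodgeRepro.Tier4.Line4

open Summit.Ventures.HodgeRepro.Tier4.Common Summit.Ventures.HodgeRepro.Tier4.Line1 NumberField Matrix MeasureTheory

open scoped ComplexConjugate

open scoped Classical

section Local

variable {k : Type} [Field k] [NumberField k] (q : QuadData k) (a : Fin 4 → k)
  (g g' : Matrix (Fin 4) (Fin 4) k) (hgg' : g * g' = 1) (hg'g : g' * g = 1)
  (hgΩ : g * (PlaneData.mixedRow q (a 0) (a 2)).Ω = (PlaneData.mixedRow q (a 0) (a 2)).Ω * g)
  (lam : k) (hlam : lam ≠ 0)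
  (hiso : g * (PlaneData.mixedRow q (a 1) (a 3)).B * gᵀ = lam • (PlaneData.mixedRow q (a 0) (a 2)).B)

include hlam in
/-- **the `T′`-adapted block at `w′` of an element of `T′_w`, `w ≠ w′`, is the identity** (`IsAtPlace` is preserved by
the conjugation `conjTo`; the `w′`-block of the identity component is `1`). -/
theorem locMat'_eq_one_of_mem_localTorusAt'_ne {w w' : InfinitePlace k} (hne : w ≠ w')
    {κ : GA ((PlaneData.mixedRow q (a 0) (a 2)).withTransportedTorus g g' hgg' hg'g hgΩ)}
    (hκ : κ ∈ localTorusAt' ((PlaneData.mixedRow q (a 0) (a 2)).withTransportedTorus g g' hgg' hg'g hgΩ) w) :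
    locMat' q a g g' hgg' hg'g hgΩ lam hiso w' κ = 1 := by
  have hat : IsAtPlace (PlaneData.ofLinesRow q (a 1) (a 3) (-1)) w (conjTo q a g g' hgg' hg'g hgΩ lam hiso κ) :=
    (conjTo_mem_localTorusAt_of_mem_localTorusAt' q a g g' hgg' hg'g hgΩ lam hlam hiso w hκ).2
  have hcomp : GA.infiniteComponent (PlaneData.ofLinesRow q (a 1) (a 3) (-1)) w'
      (conjTo q a g g' hgg' hg'g hgΩ lam hiso κ) = 1 := hat.2 w' hne.symm
  rw [locMat'_eq]
  funext I J
  rw [locMat_apply, locEntry, entryAt, entryAt, hcomp]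
  fin_cases I <;> fin_cases J <;> simp [lineBase, lineOmega]

include lam hlam hiso in
/-- **the weights at `w′` of an element of `T′_w`, `w ≠ w′`, are `1`.** -/
theorem weightAt'_eq_one_of_mem_localTorusAt'_ne {w w' : InfinitePlace k} (hne : w ≠ w')
    {κ : GA ((PlaneData.mixedRow q (a 0) (a 2)).withTransportedTorus g g' hgg' hg'g hgΩ)}
    (hκ : κ ∈ localTorusAt' ((PlaneData.mixedRow q (a 0) (a 2)).withTransportedTorus g g' hgg' hg'g hgΩ) w)
    (j : Fin 2) :
    weightAt' ((PlaneData.mixedRow q (a 0) (a 2)).withTransportedTorus g g' hgg' hg'g hgΩ) q w' g g' j κ = 1 := by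
  rw [← locEntry'_diag_eq_weightAt' q a g g' hgg' hg'g hgΩ lam hiso w', ← locMat'_apply,
    locMat'_eq_one_of_mem_localTorusAt'_ne q a g g' hgg' hg'g hgΩ lam hlam hiso hne hκ, Matrix.one_apply_eq]

include lam hlam hiso in
/-- **`Wt` on a local torus is the weight of that place alone**: for `κ ∈ T′_w`,
`torusWeight' eP′ eM′ κ = u₀(κ)_w ^ (−eP′ w) · u₁(κ)_w ^ (−eM′ w)`. -/
theorem torusWeight'_of_mem_localTorusAt' (eP' eM' : InfinitePlace k → ℤ) {w : InfinitePlace k}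
    {κ : GA ((PlaneData.mixedRow q (a 0) (a 2)).withTransportedTorus g g' hgg' hg'g hgΩ)}
    (hκ : κ ∈ localTorusAt' ((PlaneData.mixedRow q (a 0) (a 2)).withTransportedTorus g g' hgg' hg'g hgΩ) w) :
    torusWeight' q a g g' hgg' hg'g hgΩ eP' eM' κ =
      weightAt' ((PlaneData.mixedRow q (a 0) (a 2)).withTransportedTorus g g' hgg' hg'g hgΩ) q w g g' 0 κ ^ (-eP' w) *
        weightAt' ((PlaneData.mixedRow q (a 0) (a 2)).withTransportedTorus g g' hgg' hg'g hgΩ) q w g g' 1 κ ^ (-eM' w) := by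
  unfold torusWeight'
  rw [← Finset.mul_prod_erase (Finset.univ : Finset (InfinitePlace k)) _ (Finset.mem_univ w)]
  rw [Finset.prod_eq_one, mul_one]
  intro w' hw'
  have hne : w ≠ w' := (Finset.ne_of_mem_erase hw').symm
  rw [weightAt'_eq_one_of_mem_localTorusAt'_ne q a g g' hgg' hg'g hgΩ lam hlam hiso hne hκ 0,
    weightAt'_eq_one_of_mem_localTorusAt'_ne q a g g' hgg' hg'g hgΩ lam hlam hiso hne hκ 1, _root_.one_zpow,
    _root_.one_zpow, mul_one]

include lam hiso in
/-- `weightAt' … j 1 = 1`. -/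
theorem weightAt'_one (w : InfinitePlace k) (j : Fin 2) :
    weightAt' ((PlaneData.mixedRow q (a 0) (a 2)).withTransportedTorus g g' hgg' hg'g hgΩ) q w g g' j 1 = 1 := by
  rw [weightAt'_eq_weightAt_conjTo q a g g' hgg' hg'g hgΩ lam hiso, conjTo_one, weightAt_one]

include lam hlam hiso in
/-- **the transported weights are multiplicative on `T′(𝔸)`** (RowWeights' `weightAt_mul` at the conjugate). -/
theorem weightAt'_mul_of_mem_torusT' (w : InfinitePlace k) (hw : w.IsReal) (hcm : IsCMAt q w) (ha1 : a 1 ≠ 0)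
    (ha3 : a 3 ≠ 0) (j : Fin 2)
    {κ₁ κ₂ : GA ((PlaneData.mixedRow q (a 0) (a 2)).withTransportedTorus g g' hgg' hg'g hgΩ)}
    (hκ₁ : κ₁ ∈ torusT' ((PlaneData.mixedRow q (a 0) (a 2)).withTransportedTorus g g' hgg' hg'g hgΩ))
    (hκ₂ : κ₂ ∈ torusT' ((PlaneData.mixedRow q (a 0) (a 2)).withTransportedTorus g g' hgg' hg'g hgΩ)) :
    weightAt' ((PlaneData.mixedRow q (a 0) (a 2)).withTransportedTorus g g' hgg' hg'g hgΩ) q w g g' j (κ₁ * κ₂) =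
      weightAt' ((PlaneData.mixedRow q (a 0) (a 2)).withTransportedTorus g g' hgg' hg'g hgΩ) q w g g' j κ₁ *
        weightAt' ((PlaneData.mixedRow q (a 0) (a 2)).withTransportedTorus g g' hgg' hg'g hgΩ) q w g g' j κ₂ := by
  rw [weightAt'_eq_weightAt_conjTo q a g g' hgg' hg'g hgΩ lam hiso, weightAt'_eq_weightAt_conjTo q a g g' hgg' hg'g hgΩ lam hiso,
    weightAt'_eq_weightAt_conjTo q a g g' hgg' hg'g hgΩ lam hiso, conjTo_mul]
  exact weightAt_mul q (a 1) (a 3) (-1) w ha1 ha3 (by norm_num) hw hcm j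
    (conjTo_mem_torusT_of_mem_torusT' q a g g' hgg' hg'g hgΩ lam hlam hiso hκ₁)
    (conjTo_mem_torusT_of_mem_torusT' q a g g' hgg' hg'g hgΩ lam hlam hiso hκ₂)

include lam hiso in
/-- `torusWeight' eP′ eM′ 1 = 1`. -/
theorem torusWeight'_one (eP' eM' : InfinitePlace k → ℤ) : torusWeight' q a g g' hgg' hg'g hgΩ eP' eM' 1 = 1 := by
  unfold torusWeight'
  refine Finset.prod_eq_one fun w _ => ?_
  rw [weightAt'_one q a g g' hgg' hg'g hgΩ lam hiso, weightAt'_one q a g g' hgg' hg'g hgΩ lam hiso, _root_.one_zpow,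
    _root_.one_zpow, mul_one]

include lam hlam hiso in
/-- **`Wt` is multiplicative on `T′(𝔸)`** (every infinite place real CM). -/
theorem torusWeight'_mul (hall : ∀ w : InfinitePlace k, w.IsReal ∧ IsCMAt q w) (ha1 : a 1 ≠ 0) (ha3 : a 3 ≠ 0)
    (eP' eM' : InfinitePlace k → ℤ)
    {κ₁ κ₂ : GA ((PlaneData.mixedRow q (a 0) (a 2)).withTransportedTorus g g' hgg' hg'g hgΩ)}
    (hκ₁ : κ₁ ∈ torusT' ((PlaneData.mixedRow q (a 0) (a 2)).withTransportedTorus g g' hgg' hg'g hgΩ))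
    (hκ₂ : κ₂ ∈ torusT' ((PlaneData.mixedRow q (a 0) (a 2)).withTransportedTorus g g' hgg' hg'g hgΩ)) :
    torusWeight' q a g g' hgg' hg'g hgΩ eP' eM' (κ₁ * κ₂) =
      torusWeight' q a g g' hgg' hg'g hgΩ eP' eM' κ₁ * torusWeight' q a g g' hgg' hg'g hgΩ eP' eM' κ₂ := by
  unfold torusWeight'
  rw [← Finset.prod_mul_distrib]
  refine Finset.prod_congr rfl fun w _ => ?_
  rw [weightAt'_mul_of_mem_torusT' q a g g' hgg' hg'g hgΩ lam hlam hiso w (hall w).1 (hall w).2 ha1 ha3 0 hκ₁ hκ₂,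
    weightAt'_mul_of_mem_torusT' q a g g' hgg' hg'g hgΩ lam hlam hiso w (hall w).1 (hall w).2 ha1 ha3 1 hκ₁ hκ₂,
    mul_zpow, mul_zpow]
  ring

include lam hlam hiso in
/-- **THE MATCHING ON A LOCAL TORUS**: for `κ ∈ T′_w`, the display's binder
`ChiMatchesAt' W q w g g' (eP′ w) (eM′ w) R.chi'` (`χ′(κ) · u₀(κ)^{eP′ w} · u₁(κ)^{eM′ w} = 1`) gives
`R.chi' κ = torusWeight' eP′ eM′ κ`. -/
theorem chi'_eq_torusWeight'_of_chiMatchesAt'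
    [MeasurableSpace (GA ((PlaneData.mixedRow q (a 0) (a 2)).withTransportedTorus g g' hgg' hg'g hgΩ))]
    (R : RTFData ((PlaneData.mixedRow q (a 0) (a 2)).withTransportedTorus g g' hgg' hg'g hgΩ))
    (eP' eM' : InfinitePlace k → ℤ) {w : InfinitePlace k}
    (h : ChiMatchesAt' ((PlaneData.mixedRow q (a 0) (a 2)).withTransportedTorus g g' hgg' hg'g hgΩ) q w g g'
      (eP' w) (eM' w) R.chi')
    {κ : torusT' ((PlaneData.mixedRow q (a 0) (a 2)).withTransportedTorus g g' hgg' hg'g hgΩ)}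
    (hκ : (κ : GA ((PlaneData.mixedRow q (a 0) (a 2)).withTransportedTorus g g' hgg' hg'g hgΩ)) ∈
      localTorusAt' ((PlaneData.mixedRow q (a 0) (a 2)).withTransportedTorus g g' hgg' hg'g hgΩ) w) :
    R.chi' κ = torusWeight' q a g g' hgg' hg'g hgΩ eP' eM'
      (κ : GA ((PlaneData.mixedRow q (a 0) (a 2)).withTransportedTorus g g' hgg' hg'g hgΩ)) := by
  have h1 := h κ hκ
  rw [torusWeight'_of_mem_localTorusAt' q a g g' hgg' hg'g hgΩ lam hlam hiso eP' eM' hκ, _root_.zpow_neg,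
    _root_.zpow_neg, ← mul_inv]
  rw [mul_assoc] at h1
  exact eq_inv_of_mul_eq_one_left h1

end Local

end Summit.Ventures.HodgeRepro.Tier4.Line4

end
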